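import Summits.Schanuel.Schanuel.Theorems.ZilberEacParamSurfaceUnbalanced
import Summits.Schanuel.Schanuel.Theorems.ZilberEacParamSurfaceCase
import Summits.Schanuel.Schanuel.Theorems.ZilberEacGraphSurfaceExamples
import Summits.Schanuel.Schanuel.Theorems.ZilberEacFibrationProj
import HarnessLib

/-!
# Polynomially parametrised base curves, XIX: Mantova–Masser's density question for EVERY
# non-split surface `{(g(t), y) : Q(t; y₀, y₁) = 0}` with two `y₁`-degrees over a polynomial curve
# with `1 ≤ deg g₀ < deg g₁`

HONEST FRAMING.  Cell `pub-schanuel` (Zilber's Exponential-Algebraic Closedness, case ladder;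
host summit Schanuel), seat 2, gen 19.  THEOREM (`unprojectedDense_paramSurface₃`): let
`g₀, g₁ ∈ ℂ[t]` with `1 ≤ deg g₀ < deg g₁`, and let `Q ∈ ℂ[t, y₀, y₁]` be irreducible with two
monomials of different `y₁`-degree.  Then the exponential points of
`S(g; Q) = {(g₀(t), g₁(t), y₀, y₁) : Q(t; y₀, y₁) = 0} ⊆ ℂ² × ℂ²` are Zariski dense,
`I(S ∩ Γ_exp) = I(S)`.  If moreover `Q(t; ·)` has a zero in `(ℂˣ)²` for infinitely many `t`, then
`S` is in Mantova–Masser's case (dim-π-S-1-free), so their question (PLMS 2024 §1 p. 5, OPEN in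
general) holds for it (`unprojectedDensityQuestion_instance_paramSurface₃`).  This supersedes the
balanced-edge theorem of file XII and is the analogue over polynomial curves of gen 17's theorem
12.39 over graphs (`g₀ = t`).  Example: `y₀² + y₁² = t + 2` over the cusp `(t², t³)` (an
UNBALANCED edge).  What stays OPEN here: `Q ∈ ℂ[t, y₀]` (no `y₁`; fibre curves — the analogue of
gens 17–18's logarithmic strips), the mirror `deg g₁ < deg g₀` (index swap, bookkeeping), equal
degrees, the dictionary lemma for abstract `W` of the case over `C = g(ℂ)`, general algebraic base
curves, Fib(3,2), EC(3,2).  NOT Schanuel's conjecture (neither used nor implied; EAC ⇏ SC).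
-/

noncomputable section

open Complex MvPolynomial Filter
open Literature.NumberTheory.Transcendental Literature.ModelTheory.Zilber
open Literature.ModelTheory.ExponentialFields

set_option linter.dupNamespace false

namespace Summit.Schanuel.Schanuel.Theorems

section Main

variable (g₀ g₁ : Polynomial ℂ) {Q : MvPolynomial (Fin 3) ℂ}

/-- **MAIN THEOREM (non-split surfaces over a polynomial curve).**  `1 ≤ deg g₀ < deg g₁`, `Q`
irreducible with two monomials of different `y₁`-degree ⟹ the exponential points of
`S(g; Q) = {(g(t), y) : Q(t; y) = 0}` are Zariski dense.
[cite: MantovaMasser2023, §1 Further remarks, p. 5 (the question, open in general)] (new) -/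
theorem unprojectedDense_paramSurface₃ (hg₀ : 1 ≤ g₀.natDegree) (hlt : g₀.natDegree < g₁.natDegree)
    (hirr : Irreducible Q) (h2 : ∃ m ∈ Q.support, ∃ m' ∈ Q.support, m 2 ≠ m' 2) :
    UnprojectedDense {w : Fin 2 ⊕ Fin 2 → ℂ | ∃ t : ℂ, w (Sum.inl 0) = g₀.eval t ∧
      w (Sum.inl 1) = g₁.eval t ∧
      MvPolynomial.eval (Fin.cases t (fun i => w (Sum.inr i)) : Fin 3 → ℂ) Q = 0} := by
  obtain ⟨t, ht, hgr⟩ := exists_paramSurface_expPoints g₀ g₁ hg₀ Q h2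
    (paramCurve_dir_of_lt g₀ g₁ hg₀ hlt)
  exact unprojectedDense_paramSurface₃_of_expPoints g₀ g₁ Q ht hgr
    (isIrreducibleClosed_paramSurface₃ g₀ g₁ hg₀ hirr)
    (by rw [zariskiDim_paramSurface₃ g₀ g₁ hg₀ hirr])

/-- **Case ∧ dense**: with torus fibres over infinitely many `t` in addition, `S(g; Q)` is in
Mantova–Masser's case (dim-π-S-1-free) AND its exponential points are Zariski dense.
[cite: MantovaMasser2023, §1 Further remarks, p. 5 (the question, open in general)] (new) -/
theorem unprojectedDensityQuestion_instance_paramSurface₃ (hg₀ : 1 ≤ g₀.natDegree)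
    (hlt : g₀.natDegree < g₁.natDegree) (hirr : Irreducible Q)
    (h2 : ∃ m ∈ Q.support, ∃ m' ∈ Q.support, m 2 ≠ m' 2)
    (hfib : Set.Infinite {t : ℂ | ∃ c : Fin 2 → ℂ, c 0 ≠ 0 ∧ c 1 ≠ 0 ∧
      MvPolynomial.eval ![t, c 0, c 1] Q = 0}) :
    MMCaseDimPiOneFree {w : Fin 2 ⊕ Fin 2 → ℂ | ∃ t : ℂ, w (Sum.inl 0) = g₀.eval t ∧
        w (Sum.inl 1) = g₁.eval t ∧
        MvPolynomial.eval (Fin.cases t (fun i => w (Sum.inr i)) : Fin 3 → ℂ) Q = 0} ∧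
      UnprojectedDense {w : Fin 2 ⊕ Fin 2 → ℂ | ∃ t : ℂ, w (Sum.inl 0) = g₀.eval t ∧
        w (Sum.inl 1) = g₁.eval t ∧
        MvPolynomial.eval (Fin.cases t (fun i => w (Sum.inr i)) : Fin 3 → ℂ) Q = 0} :=
  ⟨mmCase_paramSurface₃ g₀ g₁ hg₀ (paramCurve_indep_of_ne g₀ g₁ hg₀ (by omega) (by omega)) hirr hfib,
    unprojectedDense_paramSurface₃ g₀ g₁ hg₀ hlt hirr h2⟩

/-- **If the question is posed, it holds**: on this family, `MMCaseDimPiOneFree S → UnprojectedDense S`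
(the case hypothesis is not even needed). (new) -/
theorem unprojectedDense_paramSurface₃_of_mmCase (hg₀ : 1 ≤ g₀.natDegree)
    (hlt : g₀.natDegree < g₁.natDegree) (hirr : Irreducible Q)
    (h2 : ∃ m ∈ Q.support, ∃ m' ∈ Q.support, m 2 ≠ m' 2)
    (_h : MMCaseDimPiOneFree {w : Fin 2 ⊕ Fin 2 → ℂ | ∃ t : ℂ, w (Sum.inl 0) = g₀.eval t ∧
        w (Sum.inl 1) = g₁.eval t ∧
        MvPolynomial.eval (Fin.cases t (fun i => w (Sum.inr i)) : Fin 3 → ℂ) Q = 0}) :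
    UnprojectedDense {w : Fin 2 ⊕ Fin 2 → ℂ | ∃ t : ℂ, w (Sum.inl 0) = g₀.eval t ∧
        w (Sum.inl 1) = g₁.eval t ∧
        MvPolynomial.eval (Fin.cases t (fun i => w (Sum.inr i)) : Fin 3 → ℂ) Q = 0} :=
  unprojectedDense_paramSurface₃ g₀ g₁ hg₀ hlt hirr h2

/-- **MAIN THEOREM, equal degrees with non-real leading ratio.**  `deg g₀ = deg g₁ ≥ 2`,
`lc(g₁)/lc(g₀) ∉ ℝ`, `Q` irreducible with two monomials of different `y₁`-degree ⟹ the exponential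
points of `S(g; Q)` are Zariski dense. [cite: MantovaMasser2023, §1 Further remarks, p. 5 (the
question, open in general)] (new) -/
theorem unprojectedDense_paramSurface₃_of_eq (hd : 2 ≤ g₀.natDegree)
    (heq : g₁.natDegree = g₀.natDegree)
    (him : (g₁.leadingCoeff / g₀.leadingCoeff).im ≠ 0) (hirr : Irreducible Q)
    (h2 : ∃ m ∈ Q.support, ∃ m' ∈ Q.support, m 2 ≠ m' 2) :
    UnprojectedDense {w : Fin 2 ⊕ Fin 2 → ℂ | ∃ t : ℂ, w (Sum.inl 0) = g₀.eval t ∧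
      w (Sum.inl 1) = g₁.eval t ∧
      MvPolynomial.eval (Fin.cases t (fun i => w (Sum.inr i)) : Fin 3 → ℂ) Q = 0} := by
  have hg₀ : 1 ≤ g₀.natDegree := by omega
  obtain ⟨t, ht, hgr⟩ := exists_paramSurface_expPoints g₀ g₁ hg₀ Q h2
    (paramCurve_dir_of_eq g₀ g₁ hd heq him)
  exact unprojectedDense_paramSurface₃_of_expPoints g₀ g₁ Q ht hgr
    (isIrreducibleClosed_paramSurface₃ g₀ g₁ hg₀ hirr)
    (by rw [zariskiDim_paramSurface₃ g₀ g₁ hg₀ hirr])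

/-- **Case ∧ dense, equal degrees with non-real leading ratio.** (new) -/
theorem unprojectedDensityQuestion_instance_paramSurface₃_of_eq (hd : 2 ≤ g₀.natDegree)
    (heq : g₁.natDegree = g₀.natDegree)
    (him : (g₁.leadingCoeff / g₀.leadingCoeff).im ≠ 0) (hirr : Irreducible Q)
    (h2 : ∃ m ∈ Q.support, ∃ m' ∈ Q.support, m 2 ≠ m' 2)
    (hfib : Set.Infinite {t : ℂ | ∃ c : Fin 2 → ℂ, c 0 ≠ 0 ∧ c 1 ≠ 0 ∧
      MvPolynomial.eval ![t, c 0, c 1] Q = 0}) :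
    MMCaseDimPiOneFree {w : Fin 2 ⊕ Fin 2 → ℂ | ∃ t : ℂ, w (Sum.inl 0) = g₀.eval t ∧
        w (Sum.inl 1) = g₁.eval t ∧
        MvPolynomial.eval (Fin.cases t (fun i => w (Sum.inr i)) : Fin 3 → ℂ) Q = 0} ∧
      UnprojectedDense {w : Fin 2 ⊕ Fin 2 → ℂ | ∃ t : ℂ, w (Sum.inl 0) = g₀.eval t ∧
        w (Sum.inl 1) = g₁.eval t ∧
        MvPolynomial.eval (Fin.cases t (fun i => w (Sum.inr i)) : Fin 3 → ℂ) Q = 0} :=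
  ⟨mmCase_paramSurface₃ g₀ g₁ (by omega) (paramCurve_indep_of_im_ne_zero g₀ g₁ (by omega) heq him)
      hirr hfib,
    unprojectedDense_paramSurface₃_of_eq g₀ g₁ hd heq him hirr h2⟩

end Main

/-! ## Example: the growing circle `y₀² + y₁² = t + 2` over the cusp (an unbalanced edge) -/

/-- **The growing circle over the cusp.**  `S = {(t², t³, y₀, y₁) : y₀² + y₁² = t + 2}` — a
non-split surface over the cuspidal cubic `x₀³ = x₁²` whose lower-left edge is UNBALANCED (the
monomial `t` alone has top `t`-degree on the edge `{1, t, y₁²}`) — is in Mantova–Masser's case AND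
its exponential points `(t², t³, e^{t²}, e^{t³})`, `e^{2t²} + e^{2t³} = t + 2`, are Zariski dense.
[cite: MantovaMasser2023, §1 Further remarks, p. 5 (the question, open in general)] (new) -/
theorem unprojectedDensityQuestion_instance_cusp_growingCircle :
    MMCaseDimPiOneFree {w : Fin 2 ⊕ Fin 2 → ℂ | ∃ t : ℂ,
        w (Sum.inl 0) = (Polynomial.X ^ 2 : Polynomial ℂ).eval t ∧
        w (Sum.inl 1) = (Polynomial.X ^ 3 : Polynomial ℂ).eval t ∧
        MvPolynomial.eval (Fin.cases t (fun i => w (Sum.inr i)) : Fin 3 → ℂ)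
          (X 1 ^ 2 + X 2 ^ 2 - X 0 - MvPolynomial.C 2 : MvPolynomial (Fin 3) ℂ) = 0} ∧
      UnprojectedDense {w : Fin 2 ⊕ Fin 2 → ℂ | ∃ t : ℂ,
        w (Sum.inl 0) = (Polynomial.X ^ 2 : Polynomial ℂ).eval t ∧
        w (Sum.inl 1) = (Polynomial.X ^ 3 : Polynomial ℂ).eval t ∧
        MvPolynomial.eval (Fin.cases t (fun i => w (Sum.inr i)) : Fin 3 → ℂ)
          (X 1 ^ 2 + X 2 ^ 2 - X 0 - MvPolynomial.C 2 : MvPolynomial (Fin 3) ℂ) = 0} :=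
  unprojectedDensityQuestion_instance_paramSurface₃ (Polynomial.X ^ 2) (Polynomial.X ^ 3) (by simp)
    (by simp) irreducible_PB PB_support_pair PB_torusFibres_infinite


/-! ## On the rung: threefolds fibred in curves over `S(g; Q)` meet `Γ_exp` -/

/-- **New members of `EC(3,2)` (non-split surfaces over polynomial curves).**  An irreducible threefold
`W ⊆ ℂ³ × ℂ³` of dimension `3` meeting the torus, with `dim cl[Δ₂](W ∩ G³) = 2`, whose projected
surface `cl pr(W ∩ G³)` is `S(g; Q)` (`1 ≤ deg g₀ < deg g₁`, `Q` irreducible with two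
`y₁`-degrees), meets the graph of exponentiation (THEOREM F′; no rotundity or freeness hypothesis).
[cite: MantovaMasser2023, §1 Further remarks, p. 5] (new) -/
theorem inter_expGraph_nonempty_of_fibred_over_paramSurface₃ (g₀ g₁ : Polynomial ℂ)
    (hg₀ : 1 ≤ g₀.natDegree) (hlt : g₀.natDegree < g₁.natDegree) {Q : MvPolynomial (Fin 3) ℂ}
    (hirr : Irreducible Q) (h2 : ∃ m ∈ Q.support, ∃ m' ∈ Q.support, m 2 ≠ m' 2)
    {W : Set (Fin (2 + 1) ⊕ Fin (2 + 1) → ℂ)}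
    (hW : IsIrreducibleClosed ℂ W) (hne : (W ∩ torusLocus ℂ (2 + 1)).Nonempty)
    (hdim : zariskiDim ℂ W = (2 + 1 : ℕ))
    (hfib : zariskiDim ℂ (matrixAct (dropLastMat 2) '' (W ∩ torusLocus ℂ (2 + 1))) = (2 : ℕ))
    (hV : zeroLocus ℂ (vanishingIdeal ℂ
      ((fun (w : Fin (2 + 1) ⊕ Fin (2 + 1) → ℂ) (t : Fin 2 ⊕ Fin 2) =>
        w (Sum.map Fin.castSucc Fin.castSucc t)) '' (W ∩ torusLocus ℂ (2 + 1)))) =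
      {w : Fin 2 ⊕ Fin 2 → ℂ | ∃ t : ℂ, w (Sum.inl 0) = g₀.eval t ∧ w (Sum.inl 1) = g₁.eval t ∧
        MvPolynomial.eval (Fin.cases t (fun i => w (Sum.inr i)) : Fin 3 → ℂ) Q = 0}) :
    (W ∩ expGraph ℂ (2 + 1)).Nonempty :=
  inter_expGraph_nonempty_of_unprojectedDense_proj hW hne hdim hfib
    (by rw [hV]; exact unprojectedDense_paramSurface₃ g₀ g₁ hg₀ hlt hirr h2)

end Summit.Schanuel.Schanuel.Theorems
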